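import Literature.Combinatorics.Digraph.MultidigraphArborescencesCofactors
import Literature.LinearAlgebra.Matrix.AdjugateRank
import Literature.NumberTheory.QuadraticFields.RedeiMatrixFourRank
import Literature.NumberTheory.QuadraticFields.RedeiReichardtSymbols
import Literature.NumberTheory.EllipticCurves.Smith2016.CongruentNumberRedeiDeterminant
import Summits.BirchSwinnertonDyer.BirchSwinnertonDyer.Theorems.GenusKolyvaginAtTwoFullVertexDefs
import HarnessLib

/-!
# LINE 49 «full_vertex» — the RÉDEI ADJUGATE THEOREM (pen memo #4 Thm 10.2): constant adjugate of the Rédei matrix / Laplacian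

Crux R″ `RankOneTwoTorsionResidualAtTwo` (stmt-BirchSwinnertonDyer-27478) of route GenusKolyvaginAtTwo, LINE 49
«torsion_cell_full_vertex_bsdidea1» (pen bsd-idea-1).  SUPPORT algebra/arithmetic for the class-group meaning of the
«genus bit» `det B(Q₀,p₀)` in the line's SEL bookkeeping (memo #2/#4): this file hosts §1–§5 of the pen's HOME-only brick
`line49/engine/RedeiAdjugate.lean` r2 (W-79: the pen may not propose) over the LANDED definitions `legendreBit`,
`redeiLaplacian`, `borderedLaplacian` of `…FullVertexDefs` (no copies).  The sequel `…RedeiAdjugateBordered` hosts §6–§8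
(Cor 10.3: `det B(Q₀,p₀)` = the constant cofactor of `Ĝ(insert p₀ Q₀)` `= [r₄(ℚ(√−p₀M₀)) = 0]`, unconditionally).

For an imaginary quadratic field of ODD discriminant `D = −n` (`n ≡ 3 (mod 4)` square-free) the Rédei matrix has the
all-ones vector in BOTH kernels, hence its adjugate is the constant matrix `g·J`, `g = [rank = t − 1] = [r₄(D) = 0]`; in
particular EVERY cofactor — whichever prime is deleted — is the same bit `g(D)`.

§1 (any commutative ring) `adjugate_apply_eq`: `M𝟙 = 0 ∧ Mᵀ𝟙 = 0 ⟹ adj M` is CONSTANT; `det_submatrix_compl_eq_adjugate` /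
   `det_submatrix_compl_eq`: every principal minor of corank one = every cofactor (tree: `Multidigraph.adjugate_eq_of_mulVec_one_eq_zero`,
   `adjugate_self_eq_det_submatrix_compl`).
§2 (over `𝔽₂`) `card_ker_mulVec_eq_two_pow` (rank–nullity), `rank_le_of_mulVec_one`, `adjugate_ne_zero_iff_card_ker_eq_two`
   (`adj ≠ 0 ⟺ #ker = 2`, tree `AdjugateRank`), `det_submatrix_compl_eq_one_iff`.
§3 `sum_redeiMatrix_col_eq_zero` / `redeiMatrix_transpose_mulVec_one`: for `n ≡ 3 (mod 4)` with distinct primes `∏ pᵢ = n`,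
   the COLUMNS of Li–Ma's `redeiMatrix n p` (tree `RedeiMatrixFourRank`) sum to `0` (quadratic reciprocity for the `pⱼ*`).
§4 THM 10.2 for `redeiMatrix n p`: (a) constant adjugate, (b) every corank-one principal minor `= 1 ⟺ #ker = 2`,
   (c) `⟺ #(Cl² ∩ Cl[2]) = 1` (`r₄ = 0`) for `K = ℚ(√−n)` and (d) `⟹ NoIdealClassOfOrderFour (−n)` — (c)(d) modulo the named
   fact `redeiReichardt_fourTwoCard_classGroup`, which the tree PROVES (`…_holds`), so primed unconditional forms are given.
§5 THM 10.2 for LINE 49's Finset-indexed `redeiLaplacian T` (`T` primes `≡ 3 (mod 4)`, `#T` odd): tournament reciprocity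
   `legendreBit_neg_add_legendreBit_neg`, rows/columns sum to `0`, constant adjugate, corank-one minors `= 1 ⟺ #ker = 2`.

Everything is proved (no `sorry`, standard axioms); nothing here is a statement of the line, and NOTHING HERE PROVES R″ or any
summit — BSD is not advanced by this file alone.

## References

* [LiMa2008RedeiReichardt] cited through the tree files `RedeiMatrixFourRank` / `RedeiReichardtFourRank` (Rédei–Reichardt
  `r₄ = t − 1 − rank RM(D)`); [HeathBrown1994SelmerCongruentII] §2; [Tian2014] Thm. 1.1 («no ideal class of order 4»).
-/

namespace Summit.BirchSwinnertonDyer.BirchSwinnertonDyer.Theorems.GenusKolyvaginAtTwo.FullVertex.RedeiAdjugate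

open Matrix Finset
open Literature.Combinatorics.Digraph.Multidigraph (det_eq_zero_of_mulVec_one_eq_zero
  adjugate_eq_of_mulVec_one_eq_zero adjugate_self_eq_det_submatrix_compl)
open Literature.LinearAlgebra.Matrix (adjugate_eq_zero_of_rank_add_two_le rank_adjugate_of_rank_add_one_eq)
open Literature.NumberTheory.QuadraticFields.RedeiReichardt

/-! ## §1 (any commutative ring) A square matrix with `𝟙` in BOTH kernels has a CONSTANT adjugate -/

section Generic

variable {ι R : Type*} [Fintype ι] [DecidableEq ι] [CommRing R]

/-- **(A1) All cofactors coincide.** If the rows AND the columns of `M` sum to zero (`M𝟙 = 0`, `Mᵀ𝟙 = 0`)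
then `adj M` is a constant matrix: `adj(M)_{ij} = adj(M)_{i'j'}` for all `i, j, i', j'`. [cite: HornJohnson2013, §0.8.2 (adjugate)] -/
theorem adjugate_apply_eq (M : Matrix ι ι R) (hrow : M *ᵥ (fun _ => (1 : R)) = 0)
    (hcol : Mᵀ *ᵥ (fun _ => (1 : R)) = 0) (i j i' j' : ι) : M.adjugate i j = M.adjugate i' j' := by
  have h1 : M.adjugate i j = M.adjugate i' j := adjugate_eq_of_mulVec_one_eq_zero M hrow j i i'
  have h2 : Mᵀ.adjugate j i' = Mᵀ.adjugate j' i' := adjugate_eq_of_mulVec_one_eq_zero Mᵀ hcol i' j j'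
  rw [← adjugate_transpose, transpose_apply, transpose_apply] at h2
  rw [h1, h2]

/-- **(A2) Every principal minor equals every cofactor.** Under the same hypotheses the determinant of the
principal submatrix on `{s}ᶜ` (row `s` and column `s` deleted) is `adj(M)_{ij}` for ANY `i, j`. [cite: HornJohnson2013, §0.8.2 (adjugate)] -/
theorem det_submatrix_compl_eq_adjugate (M : Matrix ι ι R) (hrow : M *ᵥ (fun _ => (1 : R)) = 0)
    (hcol : Mᵀ *ᵥ (fun _ => (1 : R)) = 0) (s i j : ι) :
    (M.submatrix (Subtype.val : ↥(({s} : Finset ι)ᶜ) → ι) Subtype.val).det = M.adjugate i j := by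
  rw [← adjugate_self_eq_det_submatrix_compl]
  exact adjugate_apply_eq M hrow hcol s s i j

/-- **(A2′) All principal minors of corank one coincide** (which index is deleted does not matter). [cite: HornJohnson2013, §0.8.2 (adjugate)] -/
theorem det_submatrix_compl_eq (M : Matrix ι ι R) (hrow : M *ᵥ (fun _ => (1 : R)) = 0)
    (hcol : Mᵀ *ᵥ (fun _ => (1 : R)) = 0) (s s' : ι) :
    (M.submatrix (Subtype.val : ↥(({s} : Finset ι)ᶜ) → ι) Subtype.val).det =
      (M.submatrix (Subtype.val : ↥(({s'} : Finset ι)ᶜ) → ι) Subtype.val).det := by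
  rw [det_submatrix_compl_eq_adjugate M hrow hcol s s' s', adjugate_self_eq_det_submatrix_compl]

end Generic

/-! ## §2 (over `𝔽₂`, any finite linearly ordered index type) The constant is `1` iff the kernel is the line `{0, 𝟙}` -/

section FTwo

variable {ι : Type*} [Fintype ι] [LinearOrder ι]

/-- Rank–nullity over `𝔽₂`: `#{v : Mv = 0} = 2^(#ι − rank M)`. [cite: HornJohnson2013, §0.8.2 (adjugate), §0.4.4 (rank–nullity)] -/
theorem card_ker_mulVec_eq_two_pow (M : Matrix ι ι (ZMod 2)) :
    Fintype.card {v : ι → ZMod 2 // M *ᵥ v = 0} = 2 ^ (Fintype.card ι - M.rank) := by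
  have hrn := LinearMap.finrank_range_add_finrank_ker M.mulVecLin
  rw [Module.finrank_pi (ZMod 2)] at hrn
  have hker : Module.finrank (ZMod 2) (LinearMap.ker M.mulVecLin) = Fintype.card ι - M.rank := by
    rw [Matrix.rank]
    omega
  have hcard : Nat.card (LinearMap.ker M.mulVecLin) = 2 ^ (Fintype.card ι - M.rank) := by
    rw [Module.natCard_eq_pow_finrank (K := ZMod 2), Nat.card_zmod, hker]
  rw [← hcard, ← Nat.card_eq_fintype_card]
  exact Nat.card_congr (Equiv.subtypeEquivRight (q := fun v => v ∈ LinearMap.ker M.mulVecLin)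
    fun v => by rw [LinearMap.mem_ker, Matrix.mulVecLin_apply])

omit [LinearOrder ι] in
/-- A matrix over `𝔽₂` annihilating `𝟙 ≠ 0` has rank `≤ #ι − 1`. [cite: HornJohnson2013, §0.8.2 (adjugate), §0.4.4 (rank–nullity)] -/
theorem rank_le_of_mulVec_one (M : Matrix ι ι (ZMod 2)) (i₀ : ι)
    (hrow : M *ᵥ (fun _ => (1 : ZMod 2)) = 0) : M.rank ≤ Fintype.card ι - 1 := by
  have hrn := LinearMap.finrank_range_add_finrank_ker M.mulVecLin
  rw [Module.finrank_pi (ZMod 2)] at hrn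
  have hne : LinearMap.ker M.mulVecLin ≠ ⊥ := by
    intro hbot
    have hmem : (fun _ => (1 : ZMod 2)) ∈ LinearMap.ker M.mulVecLin := by
      rw [LinearMap.mem_ker, Matrix.mulVecLin_apply, hrow]
    rw [hbot, Submodule.mem_bot] at hmem
    exact one_ne_zero (congr_fun hmem i₀)
  have hpos : 0 < Module.finrank (ZMod 2) (LinearMap.ker M.mulVecLin) := by
    rw [Module.finrank_pos_iff]
    exact Submodule.nontrivial_iff_ne_bot.mpr hne
  rw [Matrix.rank]
  omega

/-- **(B1)** For `M` over `𝔽₂` with `M𝟙 = 0`: `adj M ≠ 0 ⟺ rank M = #ι − 1 ⟺ #ker M = 2`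
(stated as `adj M ≠ 0 ↔ #{v : Mv = 0} = 2`). [cite: HornJohnson2013, §0.8.2 (adjugate), §0.4.4 (rank–nullity)] -/
theorem adjugate_ne_zero_iff_card_ker_eq_two (M : Matrix ι ι (ZMod 2)) (i₀ : ι)
    (hrow : M *ᵥ (fun _ => (1 : ZMod 2)) = 0) :
    M.adjugate ≠ 0 ↔ Fintype.card {v : ι → ZMod 2 // M *ᵥ v = 0} = 2 := by
  haveI : Nonempty ι := ⟨i₀⟩
  have hr := rank_le_of_mulVec_one M i₀ hrow
  have hcpos : 0 < Fintype.card ι := Fintype.card_pos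
  rw [card_ker_mulVec_eq_two_pow]
  constructor
  · intro hadj
    have hrk : M.rank + 1 = Fintype.card ι := by
      by_contra hne
      exact hadj (adjugate_eq_zero_of_rank_add_two_le M (by omega))
    rw [show Fintype.card ι - M.rank = 1 by omega, pow_one]
  · intro hker hadj
    have h1 : Fintype.card ι - M.rank = 1 := Nat.pow_right_injective (le_refl 2) (by simpa using hker)
    have h2 := rank_adjugate_of_rank_add_one_eq M (by omega)
    rw [hadj, Matrix.rank_zero] at h2
    exact zero_ne_one h2

/-- **(B2)** Under `M𝟙 = 0` and `Mᵀ𝟙 = 0` over `𝔽₂`: EVERY principal minor of corank one (any index `s`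
deleted) equals `1` iff `#ker M = 2` (and equals `0` otherwise). [cite: HornJohnson2013, §0.8.2 (adjugate), §0.4.4 (rank–nullity)] -/
theorem det_submatrix_compl_eq_one_iff (M : Matrix ι ι (ZMod 2))
    (hrow : M *ᵥ (fun _ => (1 : ZMod 2)) = 0) (hcol : Mᵀ *ᵥ (fun _ => (1 : ZMod 2)) = 0) (s : ι) :
    (M.submatrix (Subtype.val : ↥(({s} : Finset ι)ᶜ) → ι) Subtype.val).det = 1 ↔
      Fintype.card {v : ι → ZMod 2 // M *ᵥ v = 0} = 2 := by
  rw [← adjugate_ne_zero_iff_card_ker_eq_two M s hrow, det_submatrix_compl_eq_adjugate M hrow hcol s s s]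
  constructor
  · intro h1 h0
    rw [h0, Matrix.zero_apply] at h1
    exact zero_ne_one h1
  · intro hadj
    have h01 : ∀ x : ZMod 2, x ≠ 0 → x = 1 := by decide
    apply h01
    intro h0
    apply hadj
    ext i j
    rw [adjugate_apply_eq M hrow hcol i j s s, h0, Matrix.zero_apply]

end FTwo

/-! ## §3 (arithmetic) For `D = −n < 0`, `n ≡ 3 (mod 4)`, the COLUMNS of Li–Ma's Rédei matrix also sum to `0` -/

section Redei

open Literature.NumberTheory.EllipticCurves.Smith2016 (addLegendreSym_prod_left ite_jacobiSym_eq_addLegendreSym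
  jacobiSym_eq_one_or_neg_one_of_prime natCast_zmod_ne_zero_of_prime_ne prod_div_eq_prod_erase)
open Literature.NumberTheory.EllipticCurves.Tian2014 (IsQuadraticFieldOfSqrt fourTwoCard)
open Literature.NumberTheory.EllipticCurves.LiLiuTian2024 (NoIdealClassOfOrderFour)
open NumberField

variable {t n : ℕ} {p : Fin t → ℕ}

/-- All primes of an odd `n` are odd. [cite: LiMa2008, Thm. 0.4] [cite: RedeiReichardt1934] -/
theorem ne_two_of_prod_eq (hp : ∀ i, (p i).Prime) (hn : n % 4 = 3) (hprod : ∏ i, p i = n) (i : Fin t) :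
    p i ≠ 2 := by
  intro h2
  have hdvd : p i ∣ n := hprod ▸ Finset.dvd_prod_of_mem p (mem_univ i)
  rw [h2] at hdvd
  obtain ⟨c, hc⟩ := hdvd
  have := hp i
  omega

/-- **(C1) Column sums vanish.** For `n ≡ 3 (mod 4)` with distinct prime factors `p₁ ⋯ p_t = n` (so
`D = disc ℚ(√−n) = −n`, all `pᵢ` odd): every COLUMN of `RM(D)` sums to `0` in `𝔽₂`.  Proof: by
`redeiMatrix_transpose_apply` (quadratic reciprocity for the `pⱼ*`) the column `i` reads `[(pⱼ/pᵢ) = −1]`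
(`j ≠ i`) and `[((n/pᵢ)/pᵢ) = −1]` (`j = i`); as `n/pᵢ = ∏_{j ≠ i} pⱼ` and the symbol is multiplicative in
the top, the diagonal bit is the SUM of the others, so the column sums to twice that sum `= 0`. [cite: LiMa2008, Thm. 0.4] [cite: RedeiReichardt1934] -/
theorem sum_redeiMatrix_col_eq_zero (hp : ∀ i, (p i).Prime) (hinj : Function.Injective p) (hn : n % 4 = 3)
    (hprod : ∏ i, p i = n) (i : Fin t) : ∑ j, redeiMatrix n p j i = 0 := by
  classical
  have hprod' : ∏ i, p i = if n % 4 = 1 then 2 * n else n := by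
    rw [if_neg (by omega)]; exact hprod
  have hi2 := ne_two_of_prod_eq hp hn hprod i
  have hentry : ∀ j, redeiMatrix n p j i =
      if (if j = i then jacobiSym ((n / p i : ℕ) : ℤ) (p i) else jacobiSym (p j) (p i)) = -1 then 1 else 0 :=
    fun j => redeiMatrix_transpose_apply hp hinj hprod' hi2 j
  have hne : ∀ j ∈ univ.erase i, ((p j : ℕ) : ZMod (p i)) ≠ 0 := fun j hj =>
    natCast_zmod_ne_zero_of_prime_ne (hp i) (hp j) (fun h => (ne_of_mem_erase hj) (hinj h))
  have hdiag : redeiMatrix n p i i = ∑ j ∈ univ.erase i, redeiMatrix n p j i := by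
    rw [hentry i, if_pos rfl]
    have hdiv : n / p i = ∏ j ∈ univ.erase i, p j := by
      rw [← hprod]; exact prod_div_eq_prod_erase p hp i
    rw [hdiv]
    obtain ⟨hv, hsum⟩ := addLegendreSym_prod_left (univ.erase i) p (hp i) hne
    rw [ite_jacobiSym_eq_addLegendreSym hv, hsum]
    refine Finset.sum_congr rfl fun j hj => ?_
    rw [hentry j, if_neg (ne_of_mem_erase hj)]
    exact (ite_jacobiSym_eq_addLegendreSym (jacobiSym_eq_one_or_neg_one_of_prime (hp i)
      (by rw [Int.cast_natCast]; exact hne j hj))).symm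
  rw [← Finset.add_sum_erase _ _ (mem_univ i), hdiag]
  exact CharTwo.add_self_eq_zero _

/-- (C1) in matrix form: `RM(D)ᵀ 𝟙 = 0`. [cite: LiMa2008, Thm. 0.4] [cite: RedeiReichardt1934] -/
theorem redeiMatrix_transpose_mulVec_one (hp : ∀ i, (p i).Prime) (hinj : Function.Injective p)
    (hn : n % 4 = 3) (hprod : ∏ i, p i = n) :
    (redeiMatrix n p)ᵀ *ᵥ (fun _ => (1 : ZMod 2)) = 0 := by
  ext i
  have h := sum_redeiMatrix_col_eq_zero hp hinj hn hprod i
  simp only [mulVec, dotProduct, transpose_apply, mul_one, Pi.zero_apply]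
  exact h

/-! ## §4 THE RÉDEI ADJUGATE THEOREM (memo #4 Thm 10.2) and its class-group reading modulo Rédei–Reichardt -/

/-- **Thm 10.2 (a): the adjugate of `RM(−n)` is constant** — every cofactor of the Rédei matrix of an
imaginary quadratic field of odd discriminant `−n` is the same element `g ∈ 𝔽₂`, whichever row and column
are deleted. [cite: LiMa2008, Thm. 0.4] [cite: RedeiReichardt1934] -/
theorem redeiMatrix_adjugate_apply_eq (hp : ∀ i, (p i).Prime) (hinj : Function.Injective p)
    (hn : n % 4 = 3) (hprod : ∏ i, p i = n) (i j i' j' : Fin t) :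
    (redeiMatrix n p).adjugate i j = (redeiMatrix n p).adjugate i' j' :=
  adjugate_apply_eq _ (redeiMatrix_mulVec_one n p) (redeiMatrix_transpose_mulVec_one hp hinj hn hprod) i j i' j'

/-- **Thm 10.2 (b): every principal minor of corank one is the same bit, and it is `1` iff `#ker RM = 2`**
(`⟺ rank RM = t − 1 ⟺ r₄(−n) = 0` by Rédei–Reichardt). [cite: LiMa2008, Thm. 0.4] [cite: RedeiReichardt1934] -/
theorem det_redeiMatrix_submatrix_compl_eq_one_iff (hp : ∀ i, (p i).Prime) (hinj : Function.Injective p)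
    (hn : n % 4 = 3) (hprod : ∏ i, p i = n) (s : Fin t) :
    ((redeiMatrix n p).submatrix (Subtype.val : ↥(({s} : Finset (Fin t))ᶜ) → Fin t) Subtype.val).det = 1 ↔
      Fintype.card {v : Fin t → ZMod 2 // redeiMatrix n p *ᵥ v = 0} = 2 :=
  det_submatrix_compl_eq_one_iff _ (redeiMatrix_mulVec_one n p)
    (redeiMatrix_transpose_mulVec_one hp hinj hn hprod) s

/-- **Thm 10.2 (c), modulo the Rédei–Reichardt theorem (the tree's named fact
`redeiReichardt_fourTwoCard_classGroup`): every principal minor of corank one of `RM(−n)` equals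
`g(−n) := [#(Cl² ∩ Cl[2]) = 1] = [r₄(ℚ(√−n)) = 0] = [the genus class number 2^{1−t} h(−n) is odd]`.** [cite: LiMa2008, Thm. 0.4] [cite: RedeiReichardt1934] -/
theorem det_redeiMatrix_submatrix_compl_eq_one_iff_fourTwoCard_eq_one
    (h : redeiReichardt_fourTwoCard_classGroup) (hp : ∀ i, (p i).Prime) (hinj : Function.Injective p)
    (hn : n % 4 = 3) (hprod : ∏ i, p i = n) (s : Fin t)
    (K : Type) [Field K] [NumberField K] (hK : IsQuadraticFieldOfSqrt K (-(n : ℤ))) :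
    ((redeiMatrix n p).submatrix (Subtype.val : ↥(({s} : Finset (Fin t))ᶜ) → Fin t) Subtype.val).det = 1 ↔
      fourTwoCard (ClassGroup (𝓞 K)) = 1 := by
  have hprod' : ∏ i, p i = if n % 4 = 1 then 2 * n else n := by
    rw [if_neg (by omega)]; exact hprod
  rw [det_redeiMatrix_submatrix_compl_eq_one_iff hp hinj hn hprod s,
    card_ker_redeiMatrix_eq_two_mul_fourTwoCard h hp hinj hprod' K hK]
  omega

/-- **Thm 10.2 (d), the door actually used by LINE 49 / memo #4 Cor 10.3**: if ONE principal minor of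
corank one of `RM(−n)` is `1` (e.g. `det B = 1` for the bordered Laplacian `B` = the minor at `p₀`), then
`ℚ(√−n)` has no ideal class of order `4` — modulo Rédei–Reichardt. [cite: LiMa2008, Thm. 0.4] [cite: RedeiReichardt1934] -/
theorem noIdealClassOfOrderFour_of_det_submatrix_compl_eq_one
    (h : redeiReichardt_fourTwoCard_classGroup) (hp : ∀ i, (p i).Prime) (hinj : Function.Injective p)
    (hn : n % 4 = 3) (hprod : ∏ i, p i = n) (s : Fin t)
    (hdet : ((redeiMatrix n p).submatrix (Subtype.val : ↥(({s} : Finset (Fin t))ᶜ) → Fin t) Subtype.val).det = 1) :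
    NoIdealClassOfOrderFour (-(n : ℤ)) := by
  have hprod' : ∏ i, p i = if n % 4 = 1 then 2 * n else n := by
    rw [if_neg (by omega)]; exact hprod
  exact noIdealClassOfOrderFour_of_card_ker h hp hinj hprod'
    ((det_redeiMatrix_submatrix_compl_eq_one_iff hp hinj hn hprod s).mp hdet)

end Redei

/-! ## §5 The same theorem for LINE 49's Finset-indexed RÉDEI–LAPLACIAN (GK2 setting: all primes `≡ 3 (mod 4)`)

`legendreBit`, `redeiLaplacian`, `borderedLaplacian` are the landed `…Theorems.GenusKolyvaginAtTwo.FullVertex` definitions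
(`GenusKolyvaginAtTwoFullVertexDefs.lean`, verbatim the LINE 49 §1b bodies). -/

section FullVertex

open Literature.NumberTheory.EllipticCurves.Smith2016 (jacobiSym_eq_one_or_neg_one_of_prime natCast_zmod_ne_zero_of_prime_ne)

/-- **Reciprocity between primes `≡ 3 (mod 4)` as bits**: `[−a/b] + [−b/a] = 1` for distinct primes
`a ≡ b ≡ 3 (mod 4)` (the off-diagonal part of the Rédei–Laplacian is a TOURNAMENT). [cite: HeathBrown1994SelmerCongruentII, §2] [cite: RedeiReichardt1934] -/
theorem legendreBit_neg_add_legendreBit_neg {a b : ℕ} (ha : a.Prime) (hb : b.Prime) (hab : a ≠ b)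
    (ha3 : a % 4 = 3) (hb3 : b % 4 = 3) :
    legendreBit (-(a : ℤ)) b + legendreBit (-(b : ℤ)) a = 1 := by
  have haodd : Odd a := ha.odd_of_ne_two (by omega)
  have hbodd : Odd b := hb.odd_of_ne_two (by omega)
  have hrec : jacobiSym (a : ℤ) b = -jacobiSym (b : ℤ) a := by
    exact_mod_cast jacobiSym.quadratic_reciprocity_three_mod_four ha3 hb3
  have h1 : jacobiSym (-(a : ℤ)) b = jacobiSym (b : ℤ) a := by
    rw [neg_eq_neg_one_mul, jacobiSym.mul_left, jacobiSym.at_neg_one hbodd, ZMod.χ₄_nat_three_mod_four hb3,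
      hrec, neg_one_mul, neg_neg]
  have h2 : jacobiSym (-(b : ℤ)) a = -jacobiSym (b : ℤ) a := by
    rw [neg_eq_neg_one_mul, jacobiSym.mul_left, jacobiSym.at_neg_one haodd, ZMod.χ₄_nat_three_mod_four ha3,
      neg_one_mul]
  have hv : jacobiSym (b : ℤ) a = 1 ∨ jacobiSym (b : ℤ) a = -1 :=
    jacobiSym_eq_one_or_neg_one_of_prime ha
      (by rw [Int.cast_natCast]; exact natCast_zmod_ne_zero_of_prime_ne ha hb hab.symm)
  unfold legendreBit
  rw [h1, h2]
  rcases hv with h | h <;> rw [h] <;> decide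

variable (T : Finset ℕ)

/-- Off-diagonal entries of the Rédei–Laplacian. [cite: HeathBrown1994SelmerCongruentII, §2] [cite: RedeiReichardt1934] -/
theorem redeiLaplacian_apply_of_ne {j i : T} (h : i ≠ j) :
    redeiLaplacian T j i = legendreBit (-((i : ℕ) : ℤ)) j := by
  unfold redeiLaplacian
  rw [if_neg h]

/-- Diagonal entries of the Rédei–Laplacian: the sum of the off-diagonal entries of the row. [cite: HeathBrown1994SelmerCongruentII, §2] [cite: RedeiReichardt1934] -/
theorem redeiLaplacian_apply_self (j : T) :
    redeiLaplacian T j j = ∑ i ∈ univ.erase j, redeiLaplacian T j i := by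
  have h1 : redeiLaplacian T j j = ∑ i' : T, (if i' = j then 0 else legendreBit (-((i' : ℕ) : ℤ)) j) := by
    unfold redeiLaplacian
    rw [if_pos rfl]
  rw [h1, ← Finset.add_sum_erase _ _ (mem_univ j), if_pos rfl, zero_add]
  refine Finset.sum_congr rfl fun i hi => ?_
  rw [if_neg (ne_of_mem_erase hi), redeiLaplacian_apply_of_ne T (ne_of_mem_erase hi)]

/-- **Rows sum to `0`** (by construction, characteristic `2`). [cite: HeathBrown1994SelmerCongruentII, §2] [cite: RedeiReichardt1934] -/
theorem redeiLaplacian_mulVec_one : redeiLaplacian T *ᵥ (fun _ => (1 : ZMod 2)) = 0 := by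
  ext j
  simp only [mulVec, dotProduct, mul_one, Pi.zero_apply]
  rw [← Finset.add_sum_erase _ _ (mem_univ j), redeiLaplacian_apply_self T j]
  exact CharTwo.add_self_eq_zero _

/-- **Columns sum to `0` when `#T` is odd** (all elements of `T` primes `≡ 3 (mod 4)`): column `i` is
`Σ_{j ≠ i} ([−qⱼ/qᵢ] + [−qᵢ/qⱼ]) = Σ_{j ≠ i} 1 = #T − 1`. [cite: HeathBrown1994SelmerCongruentII, §2] [cite: RedeiReichardt1934] -/
theorem redeiLaplacian_transpose_mulVec_one (hT : ∀ q ∈ T, q.Prime ∧ q % 4 = 3) (hodd : Odd T.card) :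
    (redeiLaplacian T)ᵀ *ᵥ (fun _ => (1 : ZMod 2)) = 0 := by
  ext i
  simp only [mulVec, dotProduct, transpose_apply, mul_one, Pi.zero_apply]
  rw [← Finset.add_sum_erase _ _ (mem_univ i), redeiLaplacian_apply_self T i, ← Finset.sum_add_distrib]
  have hsum : ∀ j ∈ univ.erase i, redeiLaplacian T i j + redeiLaplacian T j i = 1 := by
    intro j hj
    have hji : j ≠ i := ne_of_mem_erase hj
    rw [redeiLaplacian_apply_of_ne T hji, redeiLaplacian_apply_of_ne T hji.symm]
    obtain ⟨hjp, hj3⟩ := hT j j.2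
    obtain ⟨hip, hi3⟩ := hT i i.2
    exact legendreBit_neg_add_legendreBit_neg hjp hip (fun h => hji (Subtype.ext h)) hj3 hi3
  rw [Finset.sum_congr rfl hsum, Finset.sum_const, Finset.card_erase_of_mem (mem_univ i), Finset.card_univ,
    Fintype.card_coe, nsmul_eq_mul, mul_one]
  obtain ⟨m, hm⟩ := hodd
  rw [hm, Nat.add_sub_cancel, Nat.cast_mul]
  have h2 : ((2 : ℕ) : ZMod 2) = 0 := by decide
  rw [h2, zero_mul]

/-- **Thm 10.2 for the Rédei–Laplacian (a): constant adjugate.** [cite: HeathBrown1994SelmerCongruentII, §2] [cite: RedeiReichardt1934] -/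
theorem redeiLaplacian_adjugate_apply_eq (hT : ∀ q ∈ T, q.Prime ∧ q % 4 = 3) (hodd : Odd T.card)
    (i j i' j' : T) : (redeiLaplacian T).adjugate i j = (redeiLaplacian T).adjugate i' j' :=
  adjugate_apply_eq _ (redeiLaplacian_mulVec_one T) (redeiLaplacian_transpose_mulVec_one T hT hodd) i j i' j'

/-- **Thm 10.2 for the Rédei–Laplacian (b)**: every principal minor of corank one is `1` iff `#ker = 2`. [cite: HeathBrown1994SelmerCongruentII, §2] [cite: RedeiReichardt1934] -/
theorem det_redeiLaplacian_submatrix_compl_eq_one_iff (hT : ∀ q ∈ T, q.Prime ∧ q % 4 = 3) (hodd : Odd T.card)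
    (s : T) :
    ((redeiLaplacian T).submatrix (Subtype.val : ↥(({s} : Finset T)ᶜ) → T) Subtype.val).det = 1 ↔
      Fintype.card {v : T → ZMod 2 // redeiLaplacian T *ᵥ v = 0} = 2 :=
  det_submatrix_compl_eq_one_iff _ (redeiLaplacian_mulVec_one T)
    (redeiLaplacian_transpose_mulVec_one T hT hodd) s

/-- Sanity instance of the tournament lemma (`norm_num` evaluates the Jacobi symbols): `[−3/7] + [−7/3] = 1`. [cite: HeathBrown1994SelmerCongruentII, §2] [cite: RedeiReichardt1934] -/
example : legendreBit (-3) 7 + legendreBit (-7) 3 = 1 := by norm_num [legendreBit]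

end FullVertex

/-! ## §4′ Thm 10.2 (c)(d) UNCONDITIONALLY (the tree proves Rédei–Reichardt: `redeiReichardt_fourTwoCard_classGroup_holds`) -/

section Unconditional

open Literature.NumberTheory.EllipticCurves.Tian2014 (IsQuadraticFieldOfSqrt fourTwoCard)
open Literature.NumberTheory.EllipticCurves.LiLiuTian2024 (NoIdealClassOfOrderFour)
open NumberField

/-- **Thm 10.2 (c), unconditional:** every corank-one principal minor of `RM(−n)` (`n ≡ 3 (mod 4)`, distinct primes
`∏ pᵢ = n`) is `1` iff `#(Cl² ∩ Cl[2])(ℚ(√−n)) = 1` (`r₄ = 0`). [cite: Tian2014, Thm. 1.1] -/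
theorem det_redeiMatrix_submatrix_compl_eq_one_iff_fourTwoCard_eq_one' {t n : ℕ} {p : Fin t → ℕ}
    (hp : ∀ i, (p i).Prime) (hinj : Function.Injective p) (hn : n % 4 = 3) (hprod : ∏ i, p i = n) (s : Fin t)
    (K : Type) [Field K] [NumberField K] (hK : IsQuadraticFieldOfSqrt K (-(n : ℤ))) :
    ((redeiMatrix n p).submatrix (Subtype.val : ↥(({s} : Finset (Fin t))ᶜ) → Fin t) Subtype.val).det = 1 ↔
      fourTwoCard (ClassGroup (𝓞 K)) = 1 :=
  det_redeiMatrix_submatrix_compl_eq_one_iff_fourTwoCard_eq_one redeiReichardt_fourTwoCard_classGroup_holds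
    hp hinj hn hprod s K hK

/-- **Thm 10.2 (d), unconditional:** one corank-one principal minor of `RM(−n)` equal to `1` ⟹ `ℚ(√−n)` has no ideal
class of order `4`. [cite: Tian2014, Thm. 1.1] -/
theorem noIdealClassOfOrderFour_of_det_submatrix_compl_eq_one' {t n : ℕ} {p : Fin t → ℕ}
    (hp : ∀ i, (p i).Prime) (hinj : Function.Injective p) (hn : n % 4 = 3) (hprod : ∏ i, p i = n) (s : Fin t)
    (hdet : ((redeiMatrix n p).submatrix (Subtype.val : ↥(({s} : Finset (Fin t))ᶜ) → Fin t) Subtype.val).det = 1) :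
    NoIdealClassOfOrderFour (-(n : ℤ)) :=
  noIdealClassOfOrderFour_of_det_submatrix_compl_eq_one redeiReichardt_fourTwoCard_classGroup_holds
    hp hinj hn hprod s hdet

end Unconditional

end Summit.BirchSwinnertonDyer.BirchSwinnertonDyer.Theorems.GenusKolyvaginAtTwo.FullVertex.RedeiAdjugate
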